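import Literature.NumberTheory.DiophantineGeometry.FunctionFieldGenus
import HarnessLib

/-!
# [AbsTopIII] §1, Props. 1.1–1.3: the additive structure of a function field from divisors

Mochizuki, *Topics in Absolute Anabelian Geometry III*, §1 "Galois-theoretic Reconstruction
Algorithms", pp. 29–31 of the author's manuscript (lit key `paper:url-5493eb38cbb7`; the journal
pagination is not held): Proposition 1.1 (Review of Linear Systems), Proposition 1.2 (Additive
Structure via Linear Systems), Proposition 1.3 (Additive Structure via Valuation and Evaluation
Maps) and Remark 1.3.1.  Setting (p. 29): "Let `X` be a hyperbolic curve over a field `k`. Write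
`K_X` for the function field of `X`"; in Props. 1.1–1.3 "`X` is proper, and `k` is algebraically
closed".

## How the setting is typed

A proper curve over an algebraically closed field is replaced by its function field: we work
with an algebraic function field of one variable `K/k` in the sense of the tree's
`Literature.NumberTheory.DiophantineGeometry.IsAlgFunctionField` (places `PlaceOver k K` = the
points `X(k)`, divisors, Riemann–Roch spaces `L(D)` and `ℓ(D)` from
`FunctionFieldDivisors` / `FunctionFieldGenus`), with `[IsAlgClosed k]`; "hyperbolic" for a
proper curve means genus `≥ 2` and is carried as the hypothesis `2 ≤ genus k K` exactly where the
text assumes it (the content of Props. 1.1–1.3 does not use it).  "`f(x) = λ`" for `f ∈ 𝒪_x` is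
the congruence `f ≡ λ mod 𝔪_x` (`HasValue`), which avoids choosing isomorphisms of residue fields
with `k`.

## Statements-first

Prop. 1.1 (i) is PROVED (it is definitional bookkeeping about `L(D) ∖ {0}`); Prop. 1.1 (ii),
Prop. 1.2 (i)–(iii), Prop. 1.3 and Rmk. 1.3.1 are NAMED FACTS `def … : Prop` quoting print.
Prop. 1.3 ("there exists a functorial algorithm for constructing the additive structure on
`K_X^× ∪ {0}` from the data (a) the group `K_X^×`, (b) the valuations `ord_x`, (c) the subgroups
`U_v = {f | f(x) = 1}`") is typed, following the cell's policy for the reconstruction genre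
(plan/FOUNDATIONS.md row 41; [AbsTopIII] Rmk. 1.9.8), on ABSTRACT data `ValuationEvaluationData`
(a group, an indexed family of `ℤ`-valued maps, an indexed family of subgroups) that do not
remember the curve, as the transport statement: every isomorphism of such data between the data
of two function fields is additive, i.e. extends to a field isomorphism (`Prop_1_3`).  With
classical choice an "algorithm" in Lean is a function of the abstract data, and its existence
together with functoriality is equivalent to this transport statement; the explicit recipe of the
algorithm is Prop. 1.2 (ii), (iii), typed separately.
-/

noncomputable section

open scoped Classical

namespace Literature.AnabelianGeometry.AbsoluteAnabelian.AbsTopIII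

open Literature.NumberTheory.DiophantineGeometry
open Literature.NumberTheory.DiophantineGeometry.AlgFunctionField

universe u v

variable {k : Type u} {K : Type v} [Field k] [Field K] [Algebra k K]

/-! ### Proposition 1.1 (Review of Linear Systems), p. 29 -/

/-- `Γ^×(E) := {f ∈ K_X | Div(f) + E ≥ 0}` ([AbsTopIII] Prop. 1.1 p. 29), as a subset of the
unit group `K_X^×` (a nonzero `f` with `(f) + E ≥ 0` is exactly a nonzero element of the
Riemann–Roch space `L(E)` of the tree's `FunctionFieldDivisors`).
[cite: MochizukiAbsTopIII2015, Prop 1.1 p.29] -/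
def gammaTimes (E : Divisor k K) : Set Kˣ :=
  {f | (f : K) ∈ riemannRochSpace E}

/-- Membership in `Γ^×(E)` (definitional). [cite: MochizukiAbsTopIII2015, Prop 1.1 p.29] -/
theorem mem_gammaTimes_iff (E : Divisor k K) (f : Kˣ) :
    f ∈ gammaTimes E ↔ (f : K) ∈ riemannRochSpace E :=
  Iff.rfl

/-- The constants `k^×` inside `K_X^×`. [cite: MochizukiAbsTopIII2015, Prop 1.1 (i) p.29] -/
def constUnits (k : Type u) (K : Type v) [Field k] [Field K] [Algebra k K] : kˣ →* Kˣ :=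
  Units.map (algebraMap k K : k →* K)

/-- Prop. 1.1 (i), first half: "`Γ^×(D)` admits a natural [...] action by `k^×`" — `Γ^×(D)` is
stable under multiplication by constants (PROVED: `L(D)` is a `k`-subspace).
[cite: MochizukiAbsTopIII2015, Prop 1.1 (i) p.29] -/
theorem constUnits_mul_mem_gammaTimes (D : Divisor k K) (c : kˣ) {f : Kˣ}
    (hf : f ∈ gammaTimes D) : constUnits k K c * f ∈ gammaTimes D := by
  change ((algebraMap k K c) * (f : K)) ∈ riemannRochSpace D
  rw [← Algebra.smul_def]
  exact Submodule.smul_mem _ _ hf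

/-- Prop. 1.1 (i): the action of `k^×` on `Γ^×(D)` is *free* (PROVED: `K_X^×` is a group and
`k → K_X` is injective). [cite: MochizukiAbsTopIII2015, Prop 1.1 (i) p.29] -/
theorem constUnits_mul_eq_self_iff (c : kˣ) (f : Kˣ) : constUnits k K c * f = f ↔ c = 1 := by
  constructor
  · intro h
    have h1 : constUnits k K c = 1 := mul_eq_right.mp h
    have h2 : (algebraMap k K) (c : k) = 1 := by
      simpa [constUnits] using congrArg (fun u : Kˣ => (u : K)) h1
    have h3 : (c : k) = 1 := by
      have := (algebraMap k K).injective
      apply this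
      simpa using h2
    exact Units.ext h3
  · rintro rfl
    simp

/-- Prop. 1.1 (i), second half: "there is a natural bijection `Γ^×(D) ≃ Γ(X, 𝒪_X(D)) ∖ {0}`"
(CONSTRUCTED). [cite: MochizukiAbsTopIII2015, Prop 1.1 (i) p.29] -/
def gammaTimesEquiv (D : Divisor k K) :
    gammaTimes D ≃ {s : riemannRochSpace D // s ≠ 0} where
  toFun f := ⟨⟨(f.1 : K), f.2⟩, fun h => f.1.ne_zero (congrArg Subtype.val h)⟩
  invFun s := ⟨Units.mk0 (s.1 : K) (fun h => s.2 (Subtype.ext h)), by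
    change ((Units.mk0 (s.1 : K) _ : Kˣ) : K) ∈ riemannRochSpace D
    simp⟩
  left_inv f := by
    ext
    simp
  right_inv s := by
    ext
    simp

/-- Prop. 1.1 (i): the bijection "is compatible with the `k^×`-actions on either side"
(PROVED: both are multiplication by the constant). [cite: MochizukiAbsTopIII2015, Prop 1.1 (i) p.29] -/
theorem gammaTimesEquiv_constUnits_mul (D : Divisor k K) (c : kˣ) (f : gammaTimes D) :
    ((gammaTimesEquiv D ⟨constUnits k K c * f.1, constUnits_mul_mem_gammaTimes D c f.2⟩).1 : K)
      = (c : k) • ((gammaTimesEquiv D f).1 : K) := by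
  simp [gammaTimesEquiv, constUnits, Algebra.smul_def]

/-- Prop. 1.1 (ii): "The integer `l(D) ≥ 0` is equal to the smallest nonnegative integer `d` such
that there exists an effective divisor `E` of degree `d` on `X` for which `Γ^×(D − E) = ∅`. In
particular, `l(D) = 0` if and only if `Γ^×(D) = ∅`" — for the function field `K/k` of a proper
hyperbolic curve over an algebraically closed field.  NAMED FACT ("a consequence of the
well-known theory of divisors on algebraic curves", p. 29).
[cite: MochizukiAbsTopIII2015, Prop 1.1 (ii) p.29] -/
def Prop_1_1_ii : Prop :=
  ∀ (k : Type u) (K : Type v) [Field k] [IsAlgClosed k] [Field K] [Algebra k K]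
    [IsAlgFunctionField k K], 2 ≤ genus k K →
    ∀ D : Divisor k K,
      IsLeast {d : ℕ | ∃ E : Divisor k K, E.IsEffective ∧ E.degree = d ∧
        gammaTimes (D - E) = ∅} (ell D)
      ∧ (ell D = 0 ↔ gammaTimes D = ∅)

/-! ### Evaluation at a point, p. 29–30 -/

/-- "`f(x) = λ`" for a rational function `f` and a point `x ∈ X(k)` (= a place `v` of `K/k`):
`f ∈ 𝒪_x` and `f ≡ λ (mod 𝔪_x)`, i.e. `v(f − λ) < 1` (which forces `f ∈ 𝒪_x`).  For `k`
algebraically closed every place is rational, so every `f ∈ 𝒪_x` has a unique such value.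
[cite: MochizukiAbsTopIII2015, Prop 1.2 (ii) p.29] -/
def HasValue (v : PlaceOver k K) (f : K) (a : k) : Prop :=
  v.valuation (f - algebraMap k K a) < 1

/-- "`g(y) = f(y)`": `f, g` take the same value at the point `y`, i.e. `v(f − g) < 1`
([AbsTopIII] Prop. 1.2 (iii) p. 30, "`g(y₁) = f_{λ,1}(y₁)`").
[cite: MochizukiAbsTopIII2015, Prop 1.2 (iii) p.30] -/
def SameValueAt (v : PlaceOver k K) (f g : K) : Prop :=
  v.valuation (f - g) < 1

/-- The point divisor `[x]` of a place. [cite: MochizukiAbsTopIII2015, Prop 1.2 (i) p.29] -/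
abbrev pointDivisor (v : PlaceOver k K) : Divisor k K := Finsupp.single v 1

/-! ### Proposition 1.2 (Additive Structure via Linear Systems), pp. 29–30 -/

/-- The data of Prop. 1.2 (i): "distinct points `x, y₁, y₂ ∈ X(k)`, together with a divisor `D`
on `X` such that `x, y₁, y₂ ∉ Supp(D)`, such that `l(D) = 2`, `l(D − E) = 0`, for any effective
divisor `E = e₁ + e₂`, where `e₁ ≠ e₂`, `{e₁, e₂} ⊆ {x, y₁, y₂}`".
[cite: MochizukiAbsTopIII2015, Prop 1.2 (i) p.29] -/
@[mk_iff] structure IsLinearSystemData (D : Divisor k K) (x y₁ y₂ : PlaceOver k K) : Prop where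
  /-- the three points are distinct -/
  x_ne_y₁ : x ≠ y₁
  /-- the three points are distinct -/
  x_ne_y₂ : x ≠ y₂
  /-- the three points are distinct -/
  y₁_ne_y₂ : y₁ ≠ y₂
  /-- `x ∉ Supp(D)` -/
  apply_x : D x = 0
  /-- `y₁ ∉ Supp(D)` -/
  apply_y₁ : D y₁ = 0
  /-- `y₂ ∉ Supp(D)` -/
  apply_y₂ : D y₂ = 0
  /-- `l(D) = 2` -/
  ell_eq_two : ell D = 2
  /-- `l(D − x − y₁) = 0` -/
  ell_sub_x_y₁ : ell (D - pointDivisor x - pointDivisor y₁) = 0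
  /-- `l(D − x − y₂) = 0` -/
  ell_sub_x_y₂ : ell (D - pointDivisor x - pointDivisor y₂) = 0
  /-- `l(D − y₁ − y₂) = 0` -/
  ell_sub_y₁_y₂ : ell (D - pointDivisor y₁ - pointDivisor y₂) = 0

/-- Prop. 1.2 (i): "There exist distinct points `x, y₁, y₂ ∈ X(k)`, together with a divisor `D`
[...] such that `l(D) = 2`, `l(D − E) = 0` [...]" — for the function field of a proper hyperbolic
curve over an algebraically closed field.  NAMED FACT (proof p. 30).
[cite: MochizukiAbsTopIII2015, Prop 1.2 (i) p.29] -/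
def Prop_1_2_i : Prop :=
  ∀ (k : Type u) (K : Type v) [Field k] [IsAlgClosed k] [Field K] [Algebra k K]
    [IsAlgFunctionField k K], 2 ≤ genus k K →
    ∃ (D : Divisor k K) (x y₁ y₂ : PlaceOver k K), IsLinearSystemData D x y₁ y₂

/-- The function `f_{λ,i}` of Prop. 1.2 (ii), as a predicate: "`f_{λ,i} ∈ Γ^×(D) ⊆ K_X` such that
`f_{λ,i}(x) = λ`, `f_{λ,i}(y_i) ≠ 0`, `f_{λ,i}(y_{3−i}) = 0`"; here `y = y_i`, `y' = y_{3-i}`.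
[cite: MochizukiAbsTopIII2015, Prop 1.2 (ii) p.29] -/
@[mk_iff] structure IsInterpolant (D : Divisor k K) (x y y' : PlaceOver k K) (a : k) (f : K) :
    Prop where
  /-- `f ≠ 0` -/
  ne_zero : f ≠ 0
  /-- `f ∈ Γ^×(D)`, i.e. `(f) + D ≥ 0` -/
  mem : f ∈ riemannRochSpace D
  /-- `f(x) = λ` -/
  value_x : HasValue x f a
  /-- `f(y_i) ≠ 0` -/
  value_y : ¬ HasValue y f 0
  /-- `f(y_{3-i}) = 0` -/
  value_y' : HasValue y' f 0

/-- Prop. 1.2 (ii): "Let `x, y₁, y₂, D` be as in (i). Then for `i = 1, 2`, `λ ∈ k^×`, there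
exists a unique element `f_{λ,i} ∈ Γ^×(D) ⊆ K_X` such that `f_{λ,i}(x) = λ`, `f_{λ,i}(y_i) ≠ 0`,
`f_{λ,i}(y_{3−i}) = 0`."  NAMED FACT.
[cite: MochizukiAbsTopIII2015, Prop 1.2 (ii) p.29] -/
def Prop_1_2_ii : Prop :=
  ∀ (k : Type u) (K : Type v) [Field k] [IsAlgClosed k] [Field K] [Algebra k K]
    [IsAlgFunctionField k K], 2 ≤ genus k K →
    ∀ (D : Divisor k K) (x y₁ y₂ : PlaceOver k K), IsLinearSystemData D x y₁ y₂ →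
      ∀ a : k, a ≠ 0 →
        (∃! f : K, IsInterpolant D x y₁ y₂ a f) ∧ (∃! f : K, IsInterpolant D x y₂ y₁ a f)

/-- Prop. 1.2 (iii): "`λ, μ ∈ k^×` such that `λ/μ ≠ −1`; `f_{λ,1}`, `f_{μ,2} ∈ Γ^×(D)` as in (ii).
Then `f_{λ,1} + f_{μ,2} ∈ Γ^×(D)` may be characterized as the unique element `g ∈ Γ^×(D)` such
that `g(y₁) = f_{λ,1}(y₁)`, `g(y₂) = f_{μ,2}(y₂)`. In particular [...] `λ + μ ∈ k^×` may be
characterized as the element `g(x) ∈ k^×`."  NAMED FACT.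
[cite: MochizukiAbsTopIII2015, Prop 1.2 (iii) p.30] -/
def Prop_1_2_iii : Prop :=
  ∀ (k : Type u) (K : Type v) [Field k] [IsAlgClosed k] [Field K] [Algebra k K]
    [IsAlgFunctionField k K], 2 ≤ genus k K →
    ∀ (D : Divisor k K) (x y₁ y₂ : PlaceOver k K), IsLinearSystemData D x y₁ y₂ →
      ∀ (a b : k) (f₁ f₂ : K), a ≠ 0 → b ≠ 0 → a / b ≠ -1 →
        IsInterpolant D x y₁ y₂ a f₁ → IsInterpolant D x y₂ y₁ b f₂ →
          (f₁ + f₂ ≠ 0 ∧ f₁ + f₂ ∈ riemannRochSpace D)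
          ∧ (∀ g : K, g ≠ 0 → g ∈ riemannRochSpace D →
              (SameValueAt y₁ g f₁ ∧ SameValueAt y₂ g f₂ ↔ g = f₁ + f₂))
          ∧ HasValue x (f₁ + f₂) (a + b)

/-! ### Proposition 1.3 (Additive Structure via Valuation and Evaluation Maps), pp. 30–31 -/

/-- "the subgroup `U_v ⊆ K_X^×` given by the `f ∈ K_X^×` such that `f(x) = 1`" ([AbsTopIII]
Prop. 1.3 (c) p. 30): the principal units `1 + 𝔪_x` at the place `v = ord_x` (a genuine
subgroup, PROVED from the valuation axioms). [cite: MochizukiAbsTopIII2015, Prop 1.3 (c) p.30] -/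
def unitsWithValueOne (v : PlaceOver k K) : Subgroup Kˣ where
  carrier := {f | HasValue v (f : K) 1}
  one_mem' := by
    change v.valuation (((1 : Kˣ) : K) - algebraMap k K 1) < 1
    simp
  mul_mem' {f g} hf hg := by
    change v.valuation (_ - algebraMap k K 1) < 1 at hf hg ⊢
    rw [map_one] at hf hg ⊢
    have hf1 : v.valuation (f : K) ≤ 1 := by
      have : (f : K) = ((f : K) - 1) + 1 := by ring
      rw [this]
      exact (Valuation.map_add _ _ _).trans (max_le hf.le (by simp))
    have key : ((f * g : Kˣ) : K) - 1 = (f : K) * ((g : K) - 1) + ((f : K) - 1) := by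
      push_cast
      ring
    rw [key]
    refine Valuation.map_add_lt _ ?_ hf
    rw [Valuation.map_mul]
    calc v.valuation (f : K) * v.valuation ((g : K) - 1)
        ≤ 1 * v.valuation ((g : K) - 1) := mul_le_mul_left hf1 _
      _ = v.valuation ((g : K) - 1) := one_mul _
      _ < 1 := hg
  inv_mem' {f} hf := by
    change v.valuation (_ - algebraMap k K 1) < 1 at hf ⊢
    rw [map_one] at hf ⊢
    have hf1 : v.valuation (f : K) = 1 := by
      have : (f : K) = 1 + ((f : K) - 1) := by ring
      rw [this, Valuation.map_add_eq_of_lt_left]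
      · simp
      · simpa using hf
    have key : ((f⁻¹ : Kˣ) : K) - 1 = ((f⁻¹ : Kˣ) : K) * (1 - (f : K)) := by
      rw [mul_sub, mul_one, Units.inv_mul]
    rw [key, Valuation.map_mul, Valuation.map_sub_swap, Units.val_inv_eq_inv_val, map_inv₀,
      hf1, inv_one, one_mul]
    exact hf

/-- Membership in `U_v`: `f ∈ U_v ↔ f(x) = 1`. [cite: MochizukiAbsTopIII2015, Prop 1.3 (c) p.30] -/
theorem mem_unitsWithValueOne_iff (v : PlaceOver k K) (f : Kˣ) :
    f ∈ unitsWithValueOne v ↔ HasValue v (f : K) 1 :=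
  Iff.rfl

/-- The ABSTRACT input data of Prop. 1.3 ("triples [...] consisting of a group, a set of
homomorphisms from the group to `ℤ`, and a collection of subgroups of the group parametrized by
elements of this set of homomorphisms", p. 30): (a) a group `G`, (b) a family `ord i : G → ℤ`
indexed by an abstract index set `I` (for a curve: `I = X(k)`, "a natural bijection
`V_X ≃ X(k)`"), (c) subgroups `U i ⊆ G`.  The data do not remember any curve or field
(plan/FOUNDATIONS.md row 41). [cite: MochizukiAbsTopIII2015, Prop 1.3 p.30] -/
structure ValuationEvaluationData : Type (v + 1) where
  /-- (a) "the [abstract!] group `K_X^×`" -/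
  G : Type v
  /-- it is a commutative group -/
  [commGroup : CommGroup G]
  /-- the index set of (b) ("`V_X ≃ X(k)`") -/
  I : Type v
  /-- (b) "the set of [surjective] homomorphisms `V_X = {ord_x : K_X^× ↠ ℤ}_{x ∈ X(k)}`" -/
  ord : I → G → ℤ
  /-- (c) "for each `v = ord_x ∈ V_X`, the subgroup `U_v ⊆ K_X^×`" -/
  U : I → Subgroup G

/-- The group structure on the datum (a). [cite: MochizukiAbsTopIII2015, Prop 1.3 (a) p.30] -/
instance ValuationEvaluationData.instCommGroup (T : ValuationEvaluationData.{v}) : CommGroup T.G :=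
  T.commGroup

/-- An *isomorphism of triples* "[in the evident sense]" (p. 30): a group isomorphism `φ` and a
reindexing `σ` with `ord'_{σ i} ∘ φ = ord_i` and `U'_{σ i} = φ(U_i)`.
[cite: MochizukiAbsTopIII2015, Prop 1.3 p.30] -/
@[mk_iff] structure ValuationEvaluationData.IsIso (T T' : ValuationEvaluationData.{v})
    (φ : T.G ≃* T'.G) (σ : T.I ≃ T'.I) : Prop where
  /-- compatibility with the valuations -/
  ord_comp : ∀ i g, T'.ord (σ i) (φ g) = T.ord i g
  /-- compatibility with the subgroups -/
  map_U : ∀ i, T'.U (σ i) = (T.U i).map φ.toMonoidHom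

variable (k K) in
/-- The triple (a), (b), (c) of Prop. 1.3 "arising from" the proper curve with function field
`K/k`: `G = K^×`, `I = X(k)` = the places of `K/k`, `ord_x`, `U_x = {f | f(x) = 1}` (REAL
construction over the tree's places). [cite: MochizukiAbsTopIII2015, Prop 1.3 p.30] -/
def valuationEvaluationData : ValuationEvaluationData.{v} where
  G := Kˣ
  I := PlaceOver k K
  ord v f := v.ord (f : K)
  U v := unitsWithValueOne v

/-- Prop. 1.3: "there exists a functorial algorithm for constructing the additive structure on
`K_X^× ∪ {0}` [i.e., arising from the field structure of `K_X`] from the following data: (a) the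
[abstract!] group `K_X^×`; (b) the set of [surjective] homomorphisms `V_X = {ord_x}` [...];
(c) [...] the subgroup `U_v ⊆ K_X^×` given by the `f` [...] such that `f(x) = 1`. Here, the term
'functorial' is with respect to isomorphisms [...] of such triples [...] arising from proper
hyperbolic curves [...] over algebraically closed fields."  TYPED (row-41 policy, transport form
on abstract data): every isomorphism between the triples of two such function fields extends,
with `0 ↦ 0`, to a field isomorphism — the additive structure is functorially determined by the
triple.  NAMED FACT (proof p. 30–31 via Props. 1.1, 1.2; "implicit in the argument of [Uchi], §3,
Lemmas 8–11 [cf. also [Tama], Lemma 4.7]"). [cite: MochizukiAbsTopIII2015, Prop 1.3 p.30] -/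
def Prop_1_3 : Prop :=
  ∀ (k : Type v) (K : Type v) [Field k] [IsAlgClosed k] [Field K] [Algebra k K]
    [IsAlgFunctionField k K] (k' : Type v) (K' : Type v) [Field k'] [IsAlgClosed k'] [Field K']
    [Algebra k' K'] [IsAlgFunctionField k' K'], 2 ≤ genus k K → 2 ≤ genus k' K' →
    ∀ (φ : Kˣ ≃* K'ˣ) (σ : PlaceOver k K ≃ PlaceOver k' K'),
      (valuationEvaluationData k K).IsIso (valuationEvaluationData k' K') φ σ →
        ∃ ψ : K ≃+* K', ∀ f : Kˣ, ψ (f : K) = (φ f : K')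

/-- Remark 1.3.1: "if `G` is an abstract group, then the datum of a surjection `v : G ↠ ℤ` may
be thought of as the datum of a subgroup `H := Ker(v)`, together with the datum of a choice of
generator of the quotient group `G/H ≃ ℤ`" — TYPED as: two surjections onto `ℤ` with the same
kernel differ at most by the automorphism `−1` of `ℤ`.  NAMED FACT (elementary).
[cite: MochizukiAbsTopIII2015, Rmk 1.3.1 p.31] -/
def Rmk_1_3_1 : Prop :=
  ∀ (G : Type u) [Group G] (v v' : G →* Multiplicative ℤ),
    Function.Surjective v → Function.Surjective v' → v.ker = v'.ker →
      v' = v ∨ ∀ g, v' g = (v g)⁻¹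

/-- DISCHARGE of `Rmk_1_3_1`: two surjections `G ↠ ℤ` with the same kernel differ at most by
the automorphism `−1` of `ℤ` (both factor through `G/H ≅ ℤ`, and `Aut(ℤ) = {±1}`).
[cite: MochizukiAbsTopIII2015, Rmk 1.3.1 p.31] -/
theorem Rmk_1_3_1_holds : Rmk_1_3_1.{u} := by
  intro G _ v v' hv hv' hker
  obtain ⟨g₀, hg₀⟩ := hv (Multiplicative.ofAdd 1)
  have key : ∀ g, v' g = v' g₀ ^ Multiplicative.toAdd (v g) := by
    intro g
    have hmem : g * g₀ ^ (-Multiplicative.toAdd (v g)) ∈ v.ker := by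
      rw [MonoidHom.mem_ker, map_mul, map_zpow, hg₀]
      apply Multiplicative.toAdd.injective
      simp
    rw [hker, MonoidHom.mem_ker, map_mul, map_zpow] at hmem
    calc v' g = v' g * v' g₀ ^ (-Multiplicative.toAdd (v g)) * v' g₀ ^ Multiplicative.toAdd (v g) := by
            rw [mul_assoc, ← zpow_add, neg_add_cancel, zpow_zero, mul_one]
      _ = v' g₀ ^ Multiplicative.toAdd (v g) := by rw [hmem, one_mul]
  have hm1 : Multiplicative.toAdd (v' g₀) = 1 ∨ Multiplicative.toAdd (v' g₀) = -1 := by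
    obtain ⟨g₁, hg₁⟩ := hv' (Multiplicative.ofAdd 1)
    have h1 := key g₁
    rw [hg₁] at h1
    have h2 : Multiplicative.toAdd (v' g₀) * Multiplicative.toAdd (v g₁) = 1 := by
      have h3 := congrArg Multiplicative.toAdd h1
      rw [toAdd_ofAdd, toAdd_zpow, smul_eq_mul] at h3
      rw [mul_comm]
      exact h3.symm
    exact Int.eq_one_or_neg_one_of_mul_eq_one h2
  rcases hm1 with h1 | h1
  · left
    ext g
    rw [key g]
    apply Multiplicative.toAdd.injective
    rw [toAdd_zpow, smul_eq_mul, h1, mul_one]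
  · right
    intro g
    rw [key g]
    apply Multiplicative.toAdd.injective
    rw [toAdd_zpow, toAdd_inv, smul_eq_mul, h1, mul_neg_one]

end Literature.AnabelianGeometry.AbsoluteAnabelian.AbsTopIII
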